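import Summits.AtomisticToContinuum.FouriersLaw.Theorems.VanishingNoiseTransferVanishingNoiseBoundFlipAsymmetryTransfer
import Summits.AtomisticToContinuum.FouriersLaw.Theorems.VanishingNoiseTransferVanishingNoiseBoundMixedLipschitzReduction

/-!
# The flip steady state of the pinned chain is `O(ε · Asym)`-close to the steady state; the exact
residual of the line's fixed-length noise continuity (helper for stub S2'
`stub_flipResponseEquidifferentiable`, line `fekete-usc-one-length`)

`--supports stmt-AtomisticToContinuum-11976` helper file (crux `VanishingNoiseBound`, route
`VanishingNoiseTransfer`). The abstract transfer estimate
(`exists_flipSteadyState_sub_le_of_flipAsymmetry`, `…FlipAsymmetryTransfer.lean`) specialised to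
`pinnedChain ω₂ lam β γ` with the resolvent kernel `R_{Nε}` of its transition semigroup
(`exists_resolventKernel_invariant`: contraction rate `κ = M N ε` towards the steady state `μ⋆`,
`μ⋆ R_{Nε} = μ⋆`):

* `exists_flipSteadyState_near_of_flipAsymmetry` — fixed `N ≥ 2`, `T_L, T_R > 0`: some weak flip
  steady state `μ` of `L + εS` has `|μ(g) - μ⋆(g)| ≤ 2 M N ε · A` for all continuous `|g| ≤ e^{θH}`,
  whenever the flip-odd part of `μ⋆` is bounded by `A` (and `Nε ≤ 1`, `MNε ≤ 1/2`). With the always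
  admissible `A = 2∫e^{θH}dμ⋆` this is the landed `exists_flipSteadyState_near`; the gain is the
  factor `A`, which VANISHES at equal temperatures (`μ⋆` = Gibbs is flip-invariant).
* `exists_flipSteadyState_totalCurrent_sub_le_of_flipAsymmetry` — all `N`, the unique weak steady
  state `μ0`: `K, ε₀` with: flip-odd part of `μ0` bounded by `A` ⟹ for `ε ≤ ε₀` some weak flip
  steady state has `|totalCurrent μ - totalCurrent μ0| ≤ K ε A`.
* `of_uniformAsymmetryTransfer` — **the exact residual**: the conclusion of
  `fixedLengthNoiseContinuity` follows from (UA) the previous statement with `K, ε₀` UNIFORM for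
  temperatures `(T+δ/2, T-δ/2)`, `0 < |δ| < δ₀` (temperature-uniform mixing constants of the
  flip-free semigroup near equilibrium), and (AS) the flip-odd part of `μ0 (T+δ/2) (T-δ/2)` is
  `O(δ)` in the `e^{θH}`-dual norm (a first-order Lipschitz bound at the flip-invariant equilibrium).
  Both are statements about the DETERMINISTIC chain; neither needs a semigroup for `L + εS` nor a
  `δ`-derivative of any steady state.
* `flipAsymmetry_le_of_near_flipInvariant` — (AS) follows from closeness (`≤ C`, here `C = O(δ)`)
  of the steady state to ANY flip-invariant measure, e.g. the Gibbs measure at `T`: (AS) is implied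
  by Lipschitz continuity at equilibrium of `δ ↦ μ0 (T+δ/2) (T-δ/2)` in the `e^{θH}`-dual norm.

No definitions.
-/

noncomputable section

namespace Summit.AtomisticToContinuum.FouriersLaw.Theorems.FixedLengthNoiseContinuity

open MeasureTheory ProbabilityTheory Filter Topology Set
open scoped NNReal ENNReal ContDiff BoundedContinuousFunction
open Literature.MathematicalPhysics.KineticTheory.HeatConduction
open Literature.Probability.Process

/-! ## §2 The pinned chain at fixed temperatures -/

section Pinned

variable {ω₂ lam β γ : ℝ} {N : ℕ} {T_L T_R : ℝ}

/-- **The flip steady state is `O(ε · Asym)`-close to the steady state** (fixed `N ≥ 2`, fixed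
`T_L, T_R > 0`, `θ = 1/(2 max(T_L,T_R))`): there are the steady state `μ⋆` of the transition
semigroup of `pinnedChain ω₂ lam β γ` and `M ≥ 0` such that, whenever the flip-odd part of `μ⋆` is
bounded by `A` on continuous `|h| ≤ e^{θH}` (`|μ⋆(h∘flip_i) - μ⋆(h)| ≤ A`, all sites `i`), for every
rate `ε > 0` with `Nε ≤ 1` and `M N ε ≤ 1/2` some weak flip steady state `μ` of `L + εS` has
`|∫ g dμ - ∫ g dμ⋆| ≤ 2 M N ε · A` for all continuous `|g| ≤ e^{θH}`
(`exists_flipSteadyState_sub_le_of_flipAsymmetry` with the resolvent kernel `R_{Nε}`,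
`κ = M N ε`: `exists_resolventKernel_invariant`). With `A = 2 ∫ e^{θH} dμ⋆` (always admissible) this
is the landed `exists_flipSteadyState_near`; at `T_L = T_R` (`μ⋆` = Gibbs, flip-invariant, `A = 0`)
it gives `μ = μ⋆` on `e^{θH}`-dominated observables. -/
theorem exists_flipSteadyState_near_of_flipAsymmetry (hω : 0 < ω₂) (hl : 0 < lam) (hβ : 0 < β)
    (hγ : 0 < γ) (hN : 1 < N) (hTL : 0 < T_L) (hTR : 0 < T_R) :
    ∃ μs : Measure (PhaseSpace N), IsProbabilityMeasure μs ∧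
      (pinnedChain ω₂ lam β γ).IsSteadyState N T_L T_R μs ∧
      ∃ M : ℝ, 0 ≤ M ∧ ∀ A : ℝ, 0 ≤ A →
        (∀ (i : Fin N) (h : PhaseSpace N → ℝ), Continuous h →
          (∀ y, |h y| ≤ Real.exp (1 / max T_L T_R / 2 *
            (pinnedChain ω₂ lam β γ).hamiltonian N y)) →
          |∫ y, h (momentumFlip i y) ∂μs - ∫ y, h y ∂μs| ≤ A) →
        ∀ ε : ℝ, 0 < ε → (N : ℝ) * ε ≤ 1 → M * ((N : ℝ) * ε) ≤ 1 / 2 →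
          ∃ μ : Measure (PhaseSpace N), (pinnedChain ω₂ lam β γ).IsFlipSteadyState N T_L T_R ε μ ∧
            ∀ g : PhaseSpace N → ℝ, Continuous g →
              (∀ y, |g y| ≤ Real.exp (1 / max T_L T_R / 2 *
                (pinnedChain ω₂ lam β γ).hamiltonian N y)) →
              |∫ y, g y ∂μ - ∫ y, g y ∂μs| ≤ 2 * M * ((N : ℝ) * ε) * A := by
  have hN0 : 0 < N := by omega
  have hmax : 0 < max T_L T_R := lt_max_of_lt_left hTL
  have hθ : 0 < 1 / max T_L T_R / 2 := by positivity
  obtain ⟨μs, hμs, hss, hμsV, a, b, M, ha, hb, hM, hR⟩ :=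
    exists_resolventKernel_invariant hω hl hβ hγ hN hTL hTR
  refine ⟨μs, hμs, hss, M, hM, fun A hA hasym ε hε hεN hMε => ?_⟩
  have hr : 0 < (N : ℝ) * ε := by positivity
  obtain ⟨R, hRM, hinvR, hres, hfel, hly, hdist⟩ := hR ((N : ℝ) * ε) hr hεN
  haveI := hRM
  have hκ0 : 0 ≤ M * ((N : ℝ) * ε) := by positivity
  have hκ1 : M * ((N : ℝ) * ε) < 1 := by linarith
  have hcontr : ∀ g : PhaseSpace N → ℝ, Continuous g →
      (∀ y, |g y| ≤ Real.exp (1 / max T_L T_R / 2 * (pinnedChain ω₂ lam β γ).hamiltonian N y)) →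
      ∀ z : PhaseSpace N, |∫ y, g y ∂(R z) - ∫ y, g y ∂μs| ≤
        M * ((N : ℝ) * ε) * Real.exp (1 / max T_L T_R / 2 * (pinnedChain ω₂ lam β γ).hamiltonian N z) :=
    fun g hg hgb z => hdist g hg hgb z
  obtain ⟨μ, hflip, hbound⟩ := exists_flipSteadyState_sub_le_of_flipAsymmetry hω hl.le hβ.le hN0
    T_L T_R ε R hres hfel hθ ha hb hly μs hμsV hinvR hκ0 hκ1 hcontr hA hasym
  refine ⟨μ, hflip, fun g hg hgb => (hbound g hg hgb).trans ?_⟩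
  -- `A κ/(1-κ) ≤ 2 A κ` for `κ ≤ 1/2`
  have h1 : (1 : ℝ) / 2 ≤ 1 - M * ((N : ℝ) * ε) := by linarith
  have hAκ : 0 ≤ A * (M * ((N : ℝ) * ε)) := mul_nonneg hA hκ0
  calc A * (M * ((N : ℝ) * ε)) / (1 - M * ((N : ℝ) * ε))
      ≤ A * (M * ((N : ℝ) * ε)) / (1 / 2) := div_le_div_of_nonneg_left hAκ (by norm_num) h1
    _ = 2 * M * ((N : ℝ) * ε) * A := by ring

/-- **Some flip steady state has steady current `O(ε · Asym)`-close to that of THE steady state**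
(any `N`, fixed `T_L, T_R > 0`; weak uniqueness of the steady state as hypothesis, as in the frame
of the stub): there are `K ≥ 0` and `ε₀ > 0` such that whenever the flip-odd part of the unique weak
steady state `μ0` is bounded by `A` on continuous `|h| ≤ e^{θH}` (`θ = 1/(2 max(T_L,T_R))`), for
every `ε ∈ (0, ε₀]` SOME weak flip steady state `μ` of `L + εS` has
`|totalCurrent μ - totalCurrent μ0| ≤ K ε A`. For `N ≤ 1` both currents vanish (`K = 0`; the point
mass, resp. the Gibbs measure at the mean temperature, is a flip steady state); for `N ≥ 2` this is
`exists_flipSteadyState_near_of_flipAsymmetry` on the dominated bond currents `|j_i| ≤ K_j e^{θH}`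
(`pinnedChain_abs_bondCurrent_le`, `one_add_sq_le_exp`). This is the FIXED-TEMPERATURE form of the
transfer bound (UT) of `…MixedLipschitzReduction.lean` (`of_uniformAsymmetryTransfer` below). -/
theorem exists_flipSteadyState_totalCurrent_sub_le_of_flipAsymmetry (hω : 0 < ω₂) (hl : 0 < lam)
    (hβ : 0 < β) (hγ : 0 < γ) (N : ℕ) (hTL : 0 < T_L) (hTR : 0 < T_R)
    (μ0 : Measure (PhaseSpace N))
    (hμ0 : (pinnedChain ω₂ lam β γ).IsSteadyState N T_L T_R μ0 ∧
      ∀ ν : Measure (PhaseSpace N), (pinnedChain ω₂ lam β γ).IsSteadyState N T_L T_R ν → ν = μ0) :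
    ∃ K ε₀ : ℝ, 0 ≤ K ∧ 0 < ε₀ ∧ ∀ A : ℝ, 0 ≤ A →
      (∀ (i : Fin N) (h : PhaseSpace N → ℝ), Continuous h →
        (∀ y, |h y| ≤ Real.exp (1 / max T_L T_R / 2 *
          (pinnedChain ω₂ lam β γ).hamiltonian N y)) →
        |∫ y, h (momentumFlip i y) ∂μ0 - ∫ y, h y ∂μ0| ≤ A) →
      ∀ ε : ℝ, 0 < ε → ε ≤ ε₀ →
        ∃ μ : Measure (PhaseSpace N), (pinnedChain ω₂ lam β γ).IsFlipSteadyState N T_L T_R ε μ ∧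
          |(pinnedChain ω₂ lam β γ).totalCurrent μ - (pinnedChain ω₂ lam β γ).totalCurrent μ0| ≤
            K * ε * A := by
  set P := pinnedChain ω₂ lam β γ with hPdef
  rcases Nat.lt_or_ge N 2 with hN2 | hN2
  · -- no bond: both currents vanish; a flip steady state exists (`N = 0`: point mass; `N = 1`: Gibbs)
    refine ⟨0, 1, le_rfl, one_pos, fun A hA _ ε hε _ => ?_⟩
    obtain ⟨μ, hμ⟩ : ∃ μ : Measure (PhaseSpace N), P.IsFlipSteadyState N T_L T_R ε μ := by
      interval_cases N
      · exact ⟨Measure.dirac default, P.isFlipSteadyState_zero_sites T_L T_R ε⟩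
      · exact ⟨_, pinnedChain_isFlipSteadyState_gibbsMeasure_one hω hl.le hβ.le γ hTL hTR ε⟩
    refine ⟨μ, hμ, ?_⟩
    rw [totalCurrent_eq_zero_of_le_one P (by omega) μ, totalCurrent_eq_zero_of_le_one P (by omega) μ0,
      sub_zero, abs_zero, zero_mul, zero_mul]
  have hN : 1 < N := hN2
  have hN0 : 0 < N := by omega
  have hNpos : (0 : ℝ) < N := by exact_mod_cast hN0
  set θ : ℝ := 1 / max T_L T_R / 2 with hθdef
  have hmax : 0 < max T_L T_R := lt_max_of_lt_left hTL
  have hθ : 0 < θ := by positivity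
  obtain ⟨μs, hμs, hss, M, hM, hnear⟩ := exists_flipSteadyState_near_of_flipAsymmetry hω hl hβ hγ hN hTL hTR
  -- `μ⋆ = μ0` by weak uniqueness
  have hμs0 : μs = μ0 := hμ0.2 μs hss
  -- domination of the bond currents: `|j_i| ≤ Kj e^{θH}`
  set Kj : ℝ := N * ((3 + β) / 2) * (2 * Real.exp θ / θ ^ 2) with hKj
  have hKj0 : 0 < Kj := by positivity
  have hdom : ∀ (i : Fin N) (x : PhaseSpace N), |P.bondCurrent N i x / Kj| ≤
      Real.exp (θ * P.hamiltonian N x) := by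
    intro i x
    have hH0 := pinnedChain_hamiltonian_nonneg hω.le hl.le hβ.le γ N x
    have hj := pinnedChain_abs_bondCurrent_le hω.le hl.le hβ.le γ N i x
    have hsq := one_add_sq_le_exp hH0 hθ
    rw [abs_div, abs_of_pos hKj0, div_le_iff₀ hKj0]
    calc |P.bondCurrent N i x| ≤ N * ((3 + β) / 2 * (1 + P.hamiltonian N x) ^ 2) := hj
      _ = N * ((3 + β) / 2) * (1 + P.hamiltonian N x) ^ 2 := by ring
      _ ≤ N * ((3 + β) / 2) * (2 * Real.exp θ / θ ^ 2 * Real.exp (θ * P.hamiltonian N x)) :=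
          mul_le_mul_of_nonneg_left hsq (by positivity)
      _ = Real.exp (θ * P.hamiltonian N x) * Kj := by rw [hKj]; ring
  -- constants: `K := 2 M N² Kj`, `ε₀ := min (1/N) (1/(2 M N + 1))`
  refine ⟨2 * M * N * (N * Kj), min (1 / N) (1 / (2 * M * N + 1)), by positivity,
    lt_min (by positivity) (by positivity), fun A hA hasym ε hε hεle => ?_⟩
  have hεN : (N : ℝ) * ε ≤ 1 := by
    have h := hεle.trans (min_le_left _ _)
    calc (N : ℝ) * ε ≤ N * (1 / N) := mul_le_mul_of_nonneg_left h hNpos.le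
      _ = 1 := by field_simp
  have hMε : M * ((N : ℝ) * ε) ≤ 1 / 2 := by
    have h := hεle.trans (min_le_right _ _)
    have hden : (0 : ℝ) < 2 * M * N + 1 := by positivity
    rw [le_div_iff₀ hden] at h
    nlinarith [mul_nonneg hM hNpos.le, hε.le]
  rw [hμs0] at hnear
  obtain ⟨μ, hμ, hg⟩ := hnear A hA hasym ε hε hεN hMε
  refine ⟨μ, hμ, ?_⟩
  -- per-bond estimate
  have hbond : ∀ i : Fin N, |∫ x, P.bondCurrent N i x ∂μ - ∫ x, P.bondCurrent N i x ∂μ0| ≤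
      Kj * (2 * M * ((N : ℝ) * ε) * A) := by
    intro i
    have h := hg (fun x => P.bondCurrent N i x / Kj)
      ((pinnedChain_continuous_bondCurrent ω₂ lam β γ N i).div_const Kj) (hdom i)
    simp only [integral_div] at h
    rw [← sub_div, abs_div, abs_of_pos hKj0, div_le_iff₀ hKj0] at h
    linarith
  -- sum over the bonds
  have hsum : |P.totalCurrent μ - P.totalCurrent μ0| ≤ N * (Kj * (2 * M * ((N : ℝ) * ε) * A)) := by
    unfold OscillatorChain.totalCurrent
    rw [← Finset.sum_sub_distrib]
    refine (Finset.abs_sum_le_sum_abs _ _).trans ?_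
    calc ∑ i : Fin N, |∫ x, P.bondCurrent N i x ∂μ - ∫ x, P.bondCurrent N i x ∂μ0|
        ≤ ∑ _i : Fin N, Kj * (2 * M * ((N : ℝ) * ε) * A) := Finset.sum_le_sum fun i _ => hbond i
      _ = N * (Kj * (2 * M * ((N : ℝ) * ε) * A)) := by simp
  refine hsum.trans (le_of_eq ?_)
  ring

end Pinned

/-! ## §3 The fixed-length noise continuity of the line from two inputs on the DETERMINISTIC chain -/

section Residual

variable {ω₂ lam β γ : ℝ}

/-- **`fixedLengthNoiseContinuity` from (UA) ∧ (AS).** Fix parameters, `T > 0`, `N`, the unique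
deterministic steady family `μ0` with response `D0` at `T`. Suppose
(UA) *uniform asymmetry transfer near equilibrium*: constants `K, ε₀ > 0, δ₀ > 0` such that for all
`0 < |δ| < δ₀`, every `A ≥ 0` bounding the flip-odd part of `μ0 (T+δ/2) (T-δ/2)` on continuous
`|h| ≤ e^{θ_δ H}` (`θ_δ = 1/(2 max(T+δ/2, T-δ/2))`), and every `ε ∈ (0, ε₀]`, some weak flip steady
state at `(T+δ/2, T-δ/2)` and rate `ε` has total current within `K ε A` of `J(μ0,δ)` — the
conclusion of `exists_flipSteadyState_totalCurrent_sub_le_of_flipAsymmetry` (PROVED at each fixed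
pair of temperatures) with `K, ε₀` UNIFORM for temperatures near `(T,T)`, i.e. temperature-uniform
mixing constants of the flip-free Langevin semigroup near equilibrium; and
(AS) *the flip-odd part of the steady state is `O(δ)`*: `C, δ₁ > 0` with
`|∫ h∘flip_i dμ0_δ - ∫ h dμ0_δ| ≤ C|δ|` for `0 < |δ| < δ₁`, all sites `i` and continuous
`|h| ≤ e^{θ_δ H}`, `μ0_δ := μ0 (T+δ/2) (T-δ/2)` — a first-order (Lipschitz) bound at the flip-invariant
equilibrium `μ0 (T,T) =` Gibbs, in the `e^{θH}`-weighted dual norm restricted to flip-odd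
observables. Then (UT) holds with constant `K C`, hence the conclusion of `fixedLengthNoiseContinuity`
(`of_uniformTransfer`). Both inputs concern the deterministic chain (`ε = 0`) only. -/
theorem of_uniformAsymmetryTransfer {T : ℝ} (hT : 0 < T) {N : ℕ}
    (μ0 : ℝ → ℝ → Measure (PhaseSpace N)) {D0 : ℝ}
    (hD0 : Tendsto (fun δ : ℝ =>
      (pinnedChain ω₂ lam β γ).totalCurrent (μ0 (T + δ / 2) (T - δ / 2)) / δ) (𝓝[≠] 0) (𝓝 D0))
    (hUA : ∃ K ε₀ δ₀ : ℝ, 0 < ε₀ ∧ 0 < δ₀ ∧ ∀ δ : ℝ, δ ≠ 0 → |δ| < δ₀ → ∀ A : ℝ, 0 ≤ A →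
      (∀ (i : Fin N) (h : PhaseSpace N → ℝ), Continuous h →
        (∀ y, |h y| ≤ Real.exp (1 / max (T + δ / 2) (T - δ / 2) / 2 *
          (pinnedChain ω₂ lam β γ).hamiltonian N y)) →
        |∫ y, h (momentumFlip i y) ∂(μ0 (T + δ / 2) (T - δ / 2)) -
            ∫ y, h y ∂(μ0 (T + δ / 2) (T - δ / 2))| ≤ A) →
      ∀ ε : ℝ, 0 < ε → ε ≤ ε₀ →
        ∃ μ : Measure (PhaseSpace N),
          (pinnedChain ω₂ lam β γ).IsFlipSteadyState N (T + δ / 2) (T - δ / 2) ε μ ∧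
            |(pinnedChain ω₂ lam β γ).totalCurrent μ -
                (pinnedChain ω₂ lam β γ).totalCurrent (μ0 (T + δ / 2) (T - δ / 2))| ≤ K * ε * A)
    (hAS : ∃ C δ₁ : ℝ, 0 < δ₁ ∧ ∀ δ : ℝ, δ ≠ 0 → |δ| < δ₁ →
      ∀ (i : Fin N) (h : PhaseSpace N → ℝ), Continuous h →
        (∀ y, |h y| ≤ Real.exp (1 / max (T + δ / 2) (T - δ / 2) / 2 *
          (pinnedChain ω₂ lam β γ).hamiltonian N y)) →
        |∫ y, h (momentumFlip i y) ∂(μ0 (T + δ / 2) (T - δ / 2)) -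
            ∫ y, h y ∂(μ0 (T + δ / 2) (T - δ / 2))| ≤ C * |δ|) :
    ∀ η : ℝ, 0 < η → ∃ ε₂ : ℝ, 0 < ε₂ ∧ ∀ ε : ℝ, 0 < ε → ε ≤ ε₂ →
      ∀ με : ℝ → ℝ → Measure (PhaseSpace N),
        (∀ T_L T_R : ℝ, 0 < T_L → 0 < T_R →
          (pinnedChain ω₂ lam β γ).IsFlipSteadyState N T_L T_R ε (με T_L T_R) ∧
            ∀ ν : Measure (PhaseSpace N),
              (pinnedChain ω₂ lam β γ).IsFlipSteadyState N T_L T_R ε ν → ν = με T_L T_R) →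
        ∀ Dε : ℝ,
          Tendsto (fun δ : ℝ =>
            (pinnedChain ω₂ lam β γ).totalCurrent (με (T + δ / 2) (T - δ / 2)) / δ)
            (𝓝[≠] 0) (𝓝 Dε) →
          |Dε - D0| ≤ η := by
  obtain ⟨K, ε₀, δ₀, hε₀, hδ₀, hUA⟩ := hUA
  obtain ⟨C, δ₁, hδ₁, hAS⟩ := hAS
  refine of_uniformTransfer hT μ0 hD0 ⟨K * max C 0, ε₀, min δ₀ δ₁, hε₀, lt_min hδ₀ hδ₁,
    fun δ hδ0 hδ ε hε hεle => ?_⟩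
  have hA : 0 ≤ max C 0 * |δ| := mul_nonneg (le_max_right _ _) (abs_nonneg _)
  have hasym := fun i h hh hhb =>
    (hAS δ hδ0 (hδ.trans_le (min_le_right _ _)) i h hh hhb).trans
      (mul_le_mul_of_nonneg_right (le_max_left C 0) (abs_nonneg δ))
  obtain ⟨μ, hμ, hb⟩ := hUA δ hδ0 (hδ.trans_le (min_le_left _ _)) (max C 0 * |δ|) hA hasym ε hε hεle
  exact ⟨μ, hμ, hb.trans (le_of_eq (by ring))⟩

end Residual

section FlipInvariantReference

variable {ω₂ lam β γ : ℝ} {N : ℕ}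

/-- **Near a flip-invariant measure ⟹ nearly flip-invariant.** If `μ0` is within `C` of a
flip-invariant measure `ν` (e.g. a Gibbs measure: `measurePreserving_momentumFlip_gibbsMeasure`) on
all continuous `|g| ≤ e^{θH}`, both measures integrating `e^{θH}`, then the flip-odd part of `μ0` is
bounded by `2C` on the same class: `μ0(h∘flip_i) - μ0(h) = 2 (μ0 - ν)(g)` for
`g = (h∘flip_i - h)/2`, `|g| ≤ e^{θH}` (`H(x^i) = H(x)`), `ν(g) = 0`. Hence input (AS) of
`of_uniformAsymmetryTransfer` follows from Lipschitz continuity at `δ = 0` of the steady state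
`δ ↦ μ0 (T+δ/2) (T-δ/2)` in the `e^{θH}`-weighted dual norm — at `δ = 0` it is the flip-invariant
Gibbs measure at `T` — i.e. Hairer–Majda's "first step" in the bath-temperature direction for the
flip-free chain. -/
theorem flipAsymmetry_le_of_near_flipInvariant (ν μ0 : Measure (PhaseSpace N)) {θ C : ℝ}
    (hν : ∀ i : Fin N, MeasurePreserving (momentumFlip i) ν ν)
    (hVν : Integrable (fun y => Real.exp (θ * (pinnedChain ω₂ lam β γ).hamiltonian N y)) ν)
    (hVμ : Integrable (fun y => Real.exp (θ * (pinnedChain ω₂ lam β γ).hamiltonian N y)) μ0)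
    (hnear : ∀ g : PhaseSpace N → ℝ, Continuous g →
      (∀ y, |g y| ≤ Real.exp (θ * (pinnedChain ω₂ lam β γ).hamiltonian N y)) →
      |∫ y, g y ∂μ0 - ∫ y, g y ∂ν| ≤ C) :
    ∀ (i : Fin N) (h : PhaseSpace N → ℝ), Continuous h →
      (∀ y, |h y| ≤ Real.exp (θ * (pinnedChain ω₂ lam β γ).hamiltonian N y)) →
      |∫ y, h (momentumFlip i y) ∂μ0 - ∫ y, h y ∂μ0| ≤ 2 * C := by
  intro i h hh hhb
  set P := pinnedChain ω₂ lam β γ with hPdef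
  have hhf : Continuous fun y => h (momentumFlip i y) := hh.comp (continuous_momentumFlip i)
  have hhfb : ∀ y, |h (momentumFlip i y)| ≤ Real.exp (θ * P.hamiltonian N y) := fun y => by
    have h1 := hhb (momentumFlip i y)
    rwa [OscillatorChain.hamiltonian_momentumFlip] at h1
  -- integrability of `h`, `h ∘ flip_i` under both measures (domination by `e^{θH}`)
  have hint : ∀ (ρ : Measure (PhaseSpace N)),
      Integrable (fun y => Real.exp (θ * P.hamiltonian N y)) ρ →
      ∀ f : PhaseSpace N → ℝ, Continuous f → (∀ y, |f y| ≤ Real.exp (θ * P.hamiltonian N y)) →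
      Integrable f ρ := fun ρ hρ f hf hfb =>
    hρ.mono' hf.aestronglyMeasurable (Eventually.of_forall fun y => by
      rw [Real.norm_eq_abs]; exact hfb y)
  set g : PhaseSpace N → ℝ := fun y => (h (momentumFlip i y) - h y) / 2 with hgdef
  have hg : Continuous g := (hhf.sub hh).div_const 2
  have hgb : ∀ y, |g y| ≤ Real.exp (θ * P.hamiltonian N y) := by
    intro y
    have h1 := hhfb y
    have h2 := hhb y
    rw [hgdef, abs_div, abs_two, div_le_iff₀ (by norm_num : (0 : ℝ) < 2)]
    exact (abs_sub _ _).trans (by linarith)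
  have hgμ : ∫ y, g y ∂μ0 = (∫ y, h (momentumFlip i y) ∂μ0 - ∫ y, h y ∂μ0) / 2 := by
    simp only [hgdef]
    rw [integral_div, integral_sub (hint μ0 hVμ _ hhf hhfb) (hint μ0 hVμ h hh hhb)]
  have hgν : ∫ y, g y ∂ν = 0 := by
    simp only [hgdef]
    rw [integral_div, integral_sub (hint ν hVν _ hhf hhfb) (hint ν hVν h hh hhb),
      integral_comp_momentumFlip (hν i), sub_self, zero_div]
  have key := hnear g hg hgb
  rw [hgμ, hgν, sub_zero, abs_div, abs_two, div_le_iff₀ (by norm_num : (0 : ℝ) < 2)] at key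
  linarith

end FlipInvariantReference

/-- Registered helper sub-goal `helper_flipAsymmetryTransferPinned` of stmt-AtomisticToContinuum-11976
(= `exists_flipSteadyState_totalCurrent_sub_le_of_flipAsymmetry`, fully quantified, notation-free
one-line form). -/
theorem helper_flipAsymmetryTransferPinned : ∀ (ω₂ lam β γ : ℝ), 0 < ω₂ → 0 < lam → 0 < β → 0 < γ → ∀ (N : ℕ) (T_L T_R : ℝ), 0 < T_L → 0 < T_R → ∀ μ0 : MeasureTheory.Measure (Literature.MathematicalPhysics.KineticTheory.HeatConduction.PhaseSpace N), ((Literature.MathematicalPhysics.KineticTheory.HeatConduction.pinnedChain ω₂ lam β γ).IsSteadyState N T_L T_R μ0 ∧ ∀ ν : MeasureTheory.Measure (Literature.MathematicalPhysics.KineticTheory.HeatConduction.PhaseSpace N), (Literature.MathematicalPhysics.KineticTheory.HeatConduction.pinnedChain ω₂ lam β γ).IsSteadyState N T_L T_R ν → ν = μ0) → ∃ K ε₀ : ℝ, 0 ≤ K ∧ 0 < ε₀ ∧ ∀ A : ℝ, 0 ≤ A → (∀ (i : Fin N) (h : Literature.MathematicalPhysics.KineticTheory.HeatConduction.PhaseSpace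 N → ℝ), Continuous h → (∀ y, |h y| ≤ Real.exp (1 / max T_L T_R / 2 * (Literature.MathematicalPhysics.KineticTheory.HeatConduction.pinnedChain ω₂ lam β γ).hamiltonian N y)) → |MeasureTheory.integral μ0 (fun y => h (Literature.MathematicalPhysics.KineticTheory.HeatConduction.momentumFlip i y)) - MeasureTheory.integral μ0 (fun y => h y)| ≤ A) → ∀ ε : ℝ, 0 < ε → ε ≤ ε₀ → ∃ μ : MeasureTheory.Measure (Literature.MathematicalPhysics.KineticTheory.HeatConduction.PhaseSpace N), (Literature.MathematicalPhysics.KineticTheory.HeatConduction.pinnedChain ω₂ lam β γ).IsFlipSteadyState N T_L T_R ε μ ∧ |(Literature.MathematicalPhysics.KineticTheory.HeatConduction.pinnedChain ω₂ lam β γ).totalCurrent μ - (Literature.MathematicalPhysics.KineticTheory.HeatConduction.pinnedChain ω₂ lam β γ).totalCurrent μ0| ≤ K * ε * A :=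
  fun _ _ _ _ hω hl hβ hγ N _ _ hTL hTR μ0 hμ0 =>
    exists_flipSteadyState_totalCurrent_sub_le_of_flipAsymmetry hω hl hβ hγ N hTL hTR μ0 hμ0

end Summit.AtomisticToContinuum.FouriersLaw.Theorems.FixedLengthNoiseContinuity

end
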